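import Summits.QuantumFields.YangMills.Theorems.BalabanUVNodesN14SourceTowerOfRecord

/-!
# BalabanUVNodes ∕ N19 — THE DRESSED SUB-LEDGER (ii-d) AND THE POSITIONAL-COUNT ROW (iv) OF THE N19′ LINK READING
# AT THE (t-N14) PIN `Ne1PinnedOfRecord`: (iv) holds outright; (ii-d) ⟺ «one top-scale dressed term per slice»

Cell `pub-ymgap`, HUMAN RULING D-0062 (Track A) ∕ D-0149 ∕ D-0154 (director-ym R399 (3a), №207 width wave), width seat
`pub-ymgap-dag-n19-w5` (generation 0).  THEOREMS ONLY (0 `def`, 0 `sorry`); imports dag-n14-w1's FILE 3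
`BalabanUVNodesN14SourceTowerOfRecord` (p593177) ONLY; modifies nothing; `--kind proof --supports` K3⁷ `SpineGivenEndpointR13SepCoPH`
(stmt-QuantumFields-20544) `--as helper` — COUNT-NEUTRAL.  Bus: CLAIM-1 ∕ INTENT-1 (R455 (A), own located gap), INBOX l.29066.

WHAT.  The K3⁷ skeleton v4 ∕ v5 (17c74fac127b5f61 ∕ 941dddb108cbaacf) pins the reading's N14 carriers BY NAME,
`Ne1PinnedOfRecord 𝔯 : ∃ l₀ Λ, 0 < l₀ ∧ 0 ≤ Λ ∧ ∀ F θ hP g₀ os, 𝔯.ne1 F θ hP g₀ os = ne1OfRecord l₀ Λ F θ hP g₀ os` (dag-n14-w1 FILE 3), so at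
every tuple and run length the bundle `R := rateCarriersOfRecord₁₃CoPH 𝔯 F θ hP g₀ os k` has
`R.ne1 = ⟨{t ∕∕ |t| ≤ l₀}, sourceTowerOfRecord ((datumOfRecord₁₃CoPH F N θ hP).scheme g₀) l₀ os, Λ⟩` — a TOP-BORN tower whose booking at `(t, K)` is
`unitScaleBooking Unit …`: `Birth = Unit`, `birthScale _ = K`, `Cube = Unit`, `cubeScale _ = K`, `feltAt _ = univ`, `size _ _ = |t| · obsSupNorm (D.scheme g₀) K os`
(all `rfl`).  Two blocks of the N19′ link reading `hlink` (dag-n19-d `…N19RateEdgeHolder.rateEdge_of_linkReading_byName_pairDiscC1Holder`; still DISPLAYED in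
dag-n19-w3 g2's edition of record `…N19RateEdgeHolderD4AtTuningWindow` :152 and :168–182; census evidence #54 on 20544: «(iv) … N14 — other node»,
«(ii-d) … NODE O, large») then read:
* (iv) `(∀ p K, (R.ne1.𝒯.B p K).PositionalCount fun j k => N₀ * Λ₀ ^ (k - j)) ∧ 0 ≤ N₀ ∧ 0 ≤ Λ₀ ∧ Λ₀ ≤ R.ne1.Λ` HOLDS at `N₀ := 1`, `Λ₀ := Λ`
  (`rateCovers_ne1OfRecord`) — §1;
* (ii-d) the six-binder clause `∃ pA βA Q pB KB βB, …` of ONE slice `(K, t, τ, v)` is EQUIVALENT, for `0 ≤ l₀`, to the ONE-TERM CLAUSE «every dressed polymer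
  has the top scale `K`; there is at most one; `#dressed ≤ vol`; its run-A activity deviation is `≤ l₀ · obsSupNorm (D.scheme g₀) K os` and its run-B deviation
  is `≤ l₀`» — §2 (generic in the slice data `Xs, sc, dA, dB, vol, K`, at the object `ne1OfRecord l₀ Λ F θ hP g₀ os` and at any carriers equal to it),
  §3 (at the bundle `rateCarriersOfRecord₁₃CoPH 𝔯 …` under the pin equation: the iff, the consumed direction ⟸ by name, and row (iv) in its ∃-letter form
  from `Ne1PinnedOfRecord 𝔯` alone).
A later edition of the link reading at the pin cites §1 to drop (iv)'s four conjuncts and §2 ∕ §3 (direction ⟸) to display the one-term clause in place of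
(ii-d); nothing of dag-n19-w3's (v′-16) programme (`…AtN16PinnedReading`) is touched.

LOCATED (count-neutral, said not asked).  At the (t-N14) pin the dressed sub-ledger of NODE O's `LedgerDataSync` world IS «≤ 1 dressed polymer per slice, at
the top scale, deviations within the bare insertion's booked size» — reading (a)'s single insertion `t·F_K` carried as ONE dressed term; a ledger that dresses
polymers BELOW the top scale cannot meet (ii-d) at this pin (§2 ⟹: `birthScale = K` forces `scale X = K`) — then the pinned tower, not (ii-d), is the edition point.

HONEST FRAMING.  By-name bookkeeping over a HYPOTHESIS shape (NODE O's world, inhabited for no family here) and dag-n14-w1's object of record; `rfl` ∕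
finite-set ∕ monotonicity facts only; ZERO estimate content; nothing of Bałaban's is asserted; NE7 ∕ NE1′ NOT PRINTED for d = 4 and NOT proved; N14 ∕ N19 NOT
discharged; this is NOT `stub_rates13H` ∕ `stub_expansion13H`; K3⁷ OPEN, not claimed; counts UNMOVED (typed 28∕28 · discharged 5∕27 · A 5∕28).  One finite
𝕋⁴ programme at fixed ε — R4 closes the CONDITIONAL rung `BalabanLadder.UV` only; the Yang–Mills mass gap (Clay) is NOT proved by any of this; nothing
continuum ∕ ℝ⁴ ∕ OS.  No summit statement is proved by this seat.  [folklore] throughout.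
-/

noncomputable section

namespace Summit.QuantumFields.YangMills.BalabanUVNodes.N19DressedLedgerAtN14Pin

open Finset
open Literature.MathematicalPhysics.QuantumFieldTheory.Balaban1983to89
open Literature.MathematicalPhysics.QuantumFieldTheory.Balaban1983to89.T4Continuum
open YMDAG.UVSplit
open YMDAG.N14.TowerGuard (RateCovers)
open YMDAG.N14.TopBorn (ne1OfRecord obsSupNorm Ne1PinnedOfRecord rateCovers_ne1OfRecord size_ne1OfRecord obsSupNorm_scheme_zero
  obsSupNorm_scheme_le_one obsSupNorm_nonneg)
open Node00 (Stage13HParams datumOfRecord₁₃CoPH)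

variable {N : ℕ} [NeZero N]

/-! ## §1 Row (iv) at the object of record: the positional count at multiplicity `1`, rate `Λ` -/

section CountRow

variable {l₀ Λ : ℝ} (F : T4Family) (θ : Stage13HParams F N) (hP : θ.Provisos₁₃CoPH F N) (g₀ : ℕ → ℝ) (os : List (ULoop F))

/-- **ROW (iv) OF THE LINK READING AT THE OBJECT OF RECORD** [bookkeeping]: the four conjuncts
`(∀ p K, PositionalCount (N₀·Λ₀^{k−j})) ∧ 0 ≤ N₀ ∧ 0 ≤ Λ₀ ∧ Λ₀ ≤ R.ne1.Λ` hold at `R.ne1 := ne1OfRecord l₀ Λ …` with `N₀ := 1`, `Λ₀ := Λ`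
— dag-n14-w1's `rateCovers_ne1OfRecord` BY NAME. [folklore] -/
theorem positionalCount_row_ne1OfRecord (hΛ : 0 ≤ Λ) :
    (∀ (p : (ne1OfRecord l₀ Λ F θ hP g₀ os).P) (K : ℕ),
        ((ne1OfRecord l₀ Λ F θ hP g₀ os).𝒯.B p K).PositionalCount fun j k => (1 : ℝ) * Λ ^ (k - j)) ∧
      (0 : ℝ) ≤ 1 ∧ 0 ≤ Λ ∧ Λ ≤ (ne1OfRecord l₀ Λ F θ hP g₀ os).Λ :=
  ⟨(rateCovers_ne1OfRecord F θ hP g₀ os hΛ).2, zero_le_one, hΛ, le_rfl⟩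

/-- Row (iv) at any carriers EQUAL to the object of record (the shape a pinned reading supplies). [folklore] -/
theorem positionalCount_row_of_eq_ne1OfRecord (hΛ : 0 ≤ Λ) {c : NE1pCarriers} (hc : c = ne1OfRecord l₀ Λ F θ hP g₀ os) :
    (∀ (p : c.P) (K : ℕ), (c.𝒯.B p K).PositionalCount fun j k => (1 : ℝ) * Λ ^ (k - j)) ∧ (0 : ℝ) ≤ 1 ∧ 0 ≤ Λ ∧ Λ ≤ c.Λ := by
  subst hc
  exact positionalCount_row_ne1OfRecord F θ hP g₀ os hΛ

end CountRow

/-! ## §2 Row (ii-d) at the object of record: the six-binder dressed-ledger clause ⟺ the one-term clause -/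

section DressedRow

variable {l₀ Λ : ℝ} (F : T4Family) (θ : Stage13HParams F N) (hP : θ.Provisos₁₃CoPH F N) (g₀ : ℕ → ℝ) (os : List (ULoop F))

/-- Births of the object of record are all equal (`Birth = Unit`). [folklore] -/
theorem birth_subsingleton (p : (ne1OfRecord l₀ Λ F θ hP g₀ os).P) (K : ℕ)
    (b b' : ((ne1OfRecord l₀ Λ F θ hP g₀ os).𝒯.B p K).Birth) : b = b' :=
  Subsingleton.elim (α := Unit) b b'

/-- Cubes of the object of record are all equal (`Cube = Unit`). [folklore] -/
theorem cube_subsingleton (p : (ne1OfRecord l₀ Λ F θ hP g₀ os).P) (K : ℕ)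
    (q q' : ((ne1OfRecord l₀ Λ F θ hP g₀ os).𝒯.B p K).Cube) : q = q' :=
  Subsingleton.elim (α := Unit) q q'

/-- **ROW (ii-d) ⟹ THE ONE-TERM CLAUSE** [bookkeeping, necessity]: at the object of record the dressed-ledger identification of one slice forces every
dressed polymer to the top scale `K`, at most one of them, `#dressed ≤ vol`, run-A deviation `≤ l₀ · obsSupNorm (D.scheme g₀) K os`, run-B deviation `≤ l₀`
(`birthScale = K`; `InjOn` into `Unit`; `Q ⊆ {()}`; `|pA|, |pB| ≤ l₀`; `obsSupNorm ≤ 1`).  No sign hypothesis on `l₀`. [folklore] -/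
theorem oneTerm_of_dressedRow_ne1OfRecord {X : Type*} (Xs : Finset X) (sc : X → ℕ) (dA dB : X → ℝ) (vol : ℝ) (K : ℕ)
    (h : ∃ (pA : (ne1OfRecord l₀ Λ F θ hP g₀ os).P) (βA : X → ((ne1OfRecord l₀ Λ F θ hP g₀ os).𝒯.B pA K).Birth)
        (Q : Finset ((ne1OfRecord l₀ Λ F θ hP g₀ os).𝒯.B pA K).Cube) (pB : (ne1OfRecord l₀ Λ F θ hP g₀ os).P) (KB : ℕ)
        (βB : X → ((ne1OfRecord l₀ Λ F θ hP g₀ os).𝒯.B pB KB).Birth),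
      (∀ x ∈ Xs, ((ne1OfRecord l₀ Λ F θ hP g₀ os).𝒯.B pA K).birthScale (βA x) = sc x) ∧
      (∀ j, Set.InjOn βA ↑(Xs.filter fun x => sc x = j)) ∧
      (∀ q ∈ Q, ((ne1OfRecord l₀ Λ F θ hP g₀ os).𝒯.B pA K).cubeScale q = K) ∧ ((Q.card : ℝ) ≤ vol) ∧
      (∀ x ∈ Xs, ∃ q ∈ Q, βA x ∈ ((ne1OfRecord l₀ Λ F θ hP g₀ os).𝒯.B pA K).feltAt q) ∧
      (∀ x ∈ Xs, KB - ((ne1OfRecord l₀ Λ F θ hP g₀ os).𝒯.B pB KB).birthScale (βB x) = K - sc x) ∧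
      (∀ x ∈ Xs, dA x ≤ ((ne1OfRecord l₀ Λ F θ hP g₀ os).𝒯.B pA K).size (βA x) K) ∧
      (∀ x ∈ Xs, dB x ≤ ((ne1OfRecord l₀ Λ F θ hP g₀ os).𝒯.B pB KB).size (βB x) KB)) :
    (∀ x ∈ Xs, sc x = K) ∧ Xs.card ≤ 1 ∧ ((Xs.card : ℝ) ≤ vol) ∧
      (∀ x ∈ Xs, dA x ≤ l₀ * obsSupNorm ((datumOfRecord₁₃CoPH F N θ hP).scheme g₀) K os) ∧ (∀ x ∈ Xs, dB x ≤ l₀) := by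
  obtain ⟨pA, βA, Q, pB, KB, βB, h1, h2, -, h4, h5, -, h7, h8⟩ := h
  -- every dressed polymer has the top scale: births of the source tower are born at `K`
  have hsc : ∀ x ∈ Xs, sc x = K := fun x hx => (h1 x hx).symm
  -- at most one: `βA` is injective on the scale-`K` slice (= all of `Xs`) and takes values in `Unit`
  have hcard : Xs.card ≤ 1 := by
    refine Finset.card_le_one.mpr fun a ha b hb => ?_
    have ha' : a ∈ (↑(Xs.filter fun x => sc x = K) : Set X) :=
      Finset.mem_coe.mpr (Finset.mem_filter.mpr ⟨ha, hsc a ha⟩)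
    have hb' : b ∈ (↑(Xs.filter fun x => sc x = K) : Set X) :=
      Finset.mem_coe.mpr (Finset.mem_filter.mpr ⟨hb, hsc b hb⟩)
    exact h2 K ha' hb' (birth_subsingleton F θ hP g₀ os pA K _ _)
  refine ⟨hsc, hcard, ?_, ?_, ?_⟩
  · -- `#dressed ≤ #Q ≤ vol`: if there is a dressed polymer the felt cube set is nonempty
    refine le_trans ?_ h4
    rcases Xs.eq_empty_or_nonempty with hXs | ⟨x, hx⟩
    · rw [hXs, Finset.card_empty, Nat.cast_zero]; exact Nat.cast_nonneg _
    · obtain ⟨q, hq, -⟩ := h5 x hx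
      have hQ : 1 ≤ Q.card := Finset.card_pos.mpr ⟨q, hq⟩
      exact_mod_cast hcard.trans hQ
  · -- run A: `size (βA x) K = |pA| · obsSupNorm_K ≤ l₀ · obsSupNorm_K`
    intro x hx
    refine (h7 x hx).trans ?_
    rw [size_ne1OfRecord]
    exact mul_le_mul_of_nonneg_right pA.2 (obsSupNorm_nonneg _ K os)
  · -- run B: `size (βB x) KB = |pB| · obsSupNorm_{KB} ≤ l₀ · 1`
    intro x hx
    refine (h8 x hx).trans ?_
    rw [size_ne1OfRecord]
    have hl₀ : 0 ≤ l₀ := (abs_nonneg _).trans pB.2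
    calc |pB.1| * obsSupNorm ((datumOfRecord₁₃CoPH F N θ hP).scheme g₀) KB os
        ≤ l₀ * 1 := mul_le_mul pB.2 (obsSupNorm_scheme_le_one (datumOfRecord₁₃CoPH F N θ hP) g₀ KB os)
          (obsSupNorm_nonneg _ KB os) hl₀
      _ = l₀ := mul_one l₀

/-- **THE ONE-TERM CLAUSE ⟹ ROW (ii-d)** [bookkeeping, the producer direction]: for `0 ≤ l₀`, witnesses `pA = pB := l₀`, `βA = βB := ()`, `Q := all cubes`
(or `∅` on an undressed slice), `KB := 0` — where the datum's sup-size is EXACTLY `1` (`obsSupNorm_scheme_zero`). [folklore] -/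
theorem dressedRow_ne1OfRecord_of_oneTerm (hl₀ : 0 ≤ l₀) {X : Type*} (Xs : Finset X) (sc : X → ℕ) (dA dB : X → ℝ) (vol : ℝ) (K : ℕ)
    (h : (∀ x ∈ Xs, sc x = K) ∧ Xs.card ≤ 1 ∧ ((Xs.card : ℝ) ≤ vol) ∧
      (∀ x ∈ Xs, dA x ≤ l₀ * obsSupNorm ((datumOfRecord₁₃CoPH F N θ hP).scheme g₀) K os) ∧ (∀ x ∈ Xs, dB x ≤ l₀)) :
    ∃ (pA : (ne1OfRecord l₀ Λ F θ hP g₀ os).P) (βA : X → ((ne1OfRecord l₀ Λ F θ hP g₀ os).𝒯.B pA K).Birth)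
        (Q : Finset ((ne1OfRecord l₀ Λ F θ hP g₀ os).𝒯.B pA K).Cube) (pB : (ne1OfRecord l₀ Λ F θ hP g₀ os).P) (KB : ℕ)
        (βB : X → ((ne1OfRecord l₀ Λ F θ hP g₀ os).𝒯.B pB KB).Birth),
      (∀ x ∈ Xs, ((ne1OfRecord l₀ Λ F θ hP g₀ os).𝒯.B pA K).birthScale (βA x) = sc x) ∧
      (∀ j, Set.InjOn βA ↑(Xs.filter fun x => sc x = j)) ∧
      (∀ q ∈ Q, ((ne1OfRecord l₀ Λ F θ hP g₀ os).𝒯.B pA K).cubeScale q = K) ∧ ((Q.card : ℝ) ≤ vol) ∧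
      (∀ x ∈ Xs, ∃ q ∈ Q, βA x ∈ ((ne1OfRecord l₀ Λ F θ hP g₀ os).𝒯.B pA K).feltAt q) ∧
      (∀ x ∈ Xs, KB - ((ne1OfRecord l₀ Λ F θ hP g₀ os).𝒯.B pB KB).birthScale (βB x) = K - sc x) ∧
      (∀ x ∈ Xs, dA x ≤ ((ne1OfRecord l₀ Λ F θ hP g₀ os).𝒯.B pA K).size (βA x) K) ∧
      (∀ x ∈ Xs, dB x ≤ ((ne1OfRecord l₀ Λ F θ hP g₀ os).𝒯.B pB KB).size (βB x) KB) := by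
  obtain ⟨hsc, hcard, hvol, hA, hB⟩ := h
  -- the source value `l₀` itself lies in the window `|t| ≤ l₀`
  have hmem : |l₀| ≤ l₀ := by rw [abs_of_nonneg hl₀]
  -- a slice of cardinality `≤ 1` carries every map injectively
  have hinj : ∀ (B : Type) (β : X → B) (j : ℕ), Set.InjOn β ↑(Xs.filter fun x => sc x = j) := by
    intro B β j a ha b hb _
    exact Finset.card_le_one.mp hcard a (Finset.mem_filter.mp (Finset.mem_coe.mp ha)).1
      b (Finset.mem_filter.mp (Finset.mem_coe.mp hb)).1
  -- the two size identities at the source `l₀`: cutoff `K` (run A) and cutoff `0` (run B, sup-size exactly `1`)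
  have hsizeA : ∀ (b : Unit) (k : ℕ), ((ne1OfRecord l₀ Λ F θ hP g₀ os).𝒯.B ⟨l₀, hmem⟩ K).size b k =
      l₀ * obsSupNorm ((datumOfRecord₁₃CoPH F N θ hP).scheme g₀) K os := by
    intro b k
    rw [size_ne1OfRecord]
    show |l₀| * _ = _
    rw [abs_of_nonneg hl₀]
  have hsizeB : ∀ (b : Unit) (k : ℕ), ((ne1OfRecord l₀ Λ F θ hP g₀ os).𝒯.B ⟨l₀, hmem⟩ 0).size b k = l₀ := by
    intro b k
    rw [size_ne1OfRecord, obsSupNorm_scheme_zero, mul_one]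
    show |l₀| = _
    rw [abs_of_nonneg hl₀]
  -- the cube set: all cubes if the slice is dressed, none otherwise
  rcases Xs.eq_empty_or_nonempty with hXs | hXs
  · subst hXs
    refine ⟨⟨l₀, hmem⟩, fun _ => PUnit.unit, ∅, ⟨l₀, hmem⟩, 0, fun _ => PUnit.unit, by simp, hinj _ _, by simp, ?_, by simp, by simp,
      by simp, by simp⟩
    rw [Finset.card_empty, Nat.cast_zero]
    rwa [Finset.card_empty, Nat.cast_zero] at hvol
  · refine ⟨⟨l₀, hmem⟩, fun _ => PUnit.unit, ((ne1OfRecord l₀ Λ F θ hP g₀ os).𝒯.B ⟨l₀, hmem⟩ K).cubes, ⟨l₀, hmem⟩, 0,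
      fun _ => PUnit.unit, fun x hx => (hsc x hx).symm, hinj _ _, fun _ _ => rfl, ?_, ?_, ?_, ?_, ?_⟩
    · -- `#cubes ≤ 1 ≤ #dressed ≤ vol`
      have hQ : (((ne1OfRecord l₀ Λ F θ hP g₀ os).𝒯.B ⟨l₀, hmem⟩ K).cubes).card ≤ 1 :=
        Finset.card_le_one.mpr fun a _ b _ => cube_subsingleton F θ hP g₀ os _ K a b
      have hX : 1 ≤ Xs.card := Finset.card_pos.mpr hXs
      exact le_trans (by exact_mod_cast hQ.trans hX) hvol
    · -- every birth is felt at the one cube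
      intro x _
      exact ⟨PUnit.unit, ((ne1OfRecord l₀ Λ F θ hP g₀ os).𝒯.B ⟨l₀, hmem⟩ K).mem_cubes _, Finset.mem_univ (α := Unit) PUnit.unit⟩
    · -- run B's scale bookkeeping: `0 − 0 = K − K`
      intro x hx
      rw [hsc x hx, Nat.sub_self]
      exact Nat.zero_sub _
    · intro x hx
      rw [hsizeA]
      exact hA x hx
    · intro x hx
      rw [hsizeB]
      exact hB x hx

/-- **ROW (ii-d) ⟺ THE ONE-TERM CLAUSE AT THE OBJECT OF RECORD**, `0 ≤ l₀`. [folklore] -/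
theorem dressedRow_ne1OfRecord_iff_oneTerm (hl₀ : 0 ≤ l₀) {X : Type*} (Xs : Finset X) (sc : X → ℕ) (dA dB : X → ℝ) (vol : ℝ) (K : ℕ) :
    (∃ (pA : (ne1OfRecord l₀ Λ F θ hP g₀ os).P) (βA : X → ((ne1OfRecord l₀ Λ F θ hP g₀ os).𝒯.B pA K).Birth)
        (Q : Finset ((ne1OfRecord l₀ Λ F θ hP g₀ os).𝒯.B pA K).Cube) (pB : (ne1OfRecord l₀ Λ F θ hP g₀ os).P) (KB : ℕ)
        (βB : X → ((ne1OfRecord l₀ Λ F θ hP g₀ os).𝒯.B pB KB).Birth),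
      (∀ x ∈ Xs, ((ne1OfRecord l₀ Λ F θ hP g₀ os).𝒯.B pA K).birthScale (βA x) = sc x) ∧
      (∀ j, Set.InjOn βA ↑(Xs.filter fun x => sc x = j)) ∧
      (∀ q ∈ Q, ((ne1OfRecord l₀ Λ F θ hP g₀ os).𝒯.B pA K).cubeScale q = K) ∧ ((Q.card : ℝ) ≤ vol) ∧
      (∀ x ∈ Xs, ∃ q ∈ Q, βA x ∈ ((ne1OfRecord l₀ Λ F θ hP g₀ os).𝒯.B pA K).feltAt q) ∧
      (∀ x ∈ Xs, KB - ((ne1OfRecord l₀ Λ F θ hP g₀ os).𝒯.B pB KB).birthScale (βB x) = K - sc x) ∧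
      (∀ x ∈ Xs, dA x ≤ ((ne1OfRecord l₀ Λ F θ hP g₀ os).𝒯.B pA K).size (βA x) K) ∧
      (∀ x ∈ Xs, dB x ≤ ((ne1OfRecord l₀ Λ F θ hP g₀ os).𝒯.B pB KB).size (βB x) KB)) ↔
    ((∀ x ∈ Xs, sc x = K) ∧ Xs.card ≤ 1 ∧ ((Xs.card : ℝ) ≤ vol) ∧
      (∀ x ∈ Xs, dA x ≤ l₀ * obsSupNorm ((datumOfRecord₁₃CoPH F N θ hP).scheme g₀) K os) ∧ (∀ x ∈ Xs, dB x ≤ l₀)) :=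
  ⟨oneTerm_of_dressedRow_ne1OfRecord F θ hP g₀ os Xs sc dA dB vol K, dressedRow_ne1OfRecord_of_oneTerm F θ hP g₀ os hl₀ Xs sc dA dB vol K⟩

/-- **ROW (ii-d) ⟺ THE ONE-TERM CLAUSE AT ANY CARRIERS EQUAL TO THE OBJECT OF RECORD** (the shape a pinned reading supplies: `c := R.ne1`,
`hc :=` the pin equation at the tuple), `0 ≤ l₀`. [folklore] -/
theorem dressedRow_iff_oneTerm_of_eq_ne1OfRecord (hl₀ : 0 ≤ l₀) {c : NE1pCarriers} (hc : c = ne1OfRecord l₀ Λ F θ hP g₀ os)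
    {X : Type*} (Xs : Finset X) (sc : X → ℕ) (dA dB : X → ℝ) (vol : ℝ) (K : ℕ) :
    (∃ (pA : c.P) (βA : X → (c.𝒯.B pA K).Birth) (Q : Finset (c.𝒯.B pA K).Cube) (pB : c.P) (KB : ℕ) (βB : X → (c.𝒯.B pB KB).Birth),
      (∀ x ∈ Xs, (c.𝒯.B pA K).birthScale (βA x) = sc x) ∧
      (∀ j, Set.InjOn βA ↑(Xs.filter fun x => sc x = j)) ∧
      (∀ q ∈ Q, (c.𝒯.B pA K).cubeScale q = K) ∧ ((Q.card : ℝ) ≤ vol) ∧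
      (∀ x ∈ Xs, ∃ q ∈ Q, βA x ∈ (c.𝒯.B pA K).feltAt q) ∧
      (∀ x ∈ Xs, KB - (c.𝒯.B pB KB).birthScale (βB x) = K - sc x) ∧
      (∀ x ∈ Xs, dA x ≤ (c.𝒯.B pA K).size (βA x) K) ∧
      (∀ x ∈ Xs, dB x ≤ (c.𝒯.B pB KB).size (βB x) KB)) ↔
    ((∀ x ∈ Xs, sc x = K) ∧ Xs.card ≤ 1 ∧ ((Xs.card : ℝ) ≤ vol) ∧
      (∀ x ∈ Xs, dA x ≤ l₀ * obsSupNorm ((datumOfRecord₁₃CoPH F N θ hP).scheme g₀) K os) ∧ (∀ x ∈ Xs, dB x ≤ l₀)) := by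
  subst hc
  exact dressedRow_ne1OfRecord_iff_oneTerm F θ hP g₀ os hl₀ Xs sc dA dB vol K

end DressedRow

/-! ## §3 At the bundle of record under the pin: rows (iv) and (ii-d) for `R := rateCarriersOfRecord₁₃CoPH 𝔯 F θ hP g₀ os k` -/

section Pinned

variable (𝔯 : RateReading₁₃CoPH N) {l₀ Λ : ℝ}

/-- **ROW (iv) AT THE BUNDLE OF RECORD UNDER THE PIN EQUATION** [bookkeeping]: `N₀ := 1`, `Λ₀ := Λ`, every tuple and run length. [folklore] -/
theorem positionalCount_row_rateCarriersOfRecord₁₃CoPH_of_pinned (hΛ : 0 ≤ Λ)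
    (hpin : ∀ (F : T4Family) (θ : Stage13HParams F N) (hP : θ.Provisos₁₃CoPH F N) (g₀ : ℕ → ℝ) (os : List (ULoop F)),
      𝔯.ne1 F θ hP g₀ os = ne1OfRecord l₀ Λ F θ hP g₀ os)
    (F : T4Family) (θ : Stage13HParams F N) (hP : θ.Provisos₁₃CoPH F N) (g₀ : ℕ → ℝ) (os : List (ULoop F)) (k : ℕ) :
    (∀ (p : (rateCarriersOfRecord₁₃CoPH 𝔯 F θ hP g₀ os k).ne1.P) (K : ℕ),
        ((rateCarriersOfRecord₁₃CoPH 𝔯 F θ hP g₀ os k).ne1.𝒯.B p K).PositionalCount fun j k' => (1 : ℝ) * Λ ^ (k' - j)) ∧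
      (0 : ℝ) ≤ 1 ∧ 0 ≤ Λ ∧ Λ ≤ (rateCarriersOfRecord₁₃CoPH 𝔯 F θ hP g₀ os k).ne1.Λ :=
  positionalCount_row_of_eq_ne1OfRecord F θ hP g₀ os hΛ (hpin F θ hP g₀ os)

/-- **ROW (ii-d) ⟺ THE ONE-TERM CLAUSE AT THE BUNDLE OF RECORD UNDER THE PIN EQUATION** [bookkeeping]: every tuple, run length and slice; `0 ≤ l₀`. [folklore] -/
theorem dressedRow_rateCarriersOfRecord₁₃CoPH_iff_oneTerm_of_pinned (hl₀ : 0 ≤ l₀)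
    (hpin : ∀ (F : T4Family) (θ : Stage13HParams F N) (hP : θ.Provisos₁₃CoPH F N) (g₀ : ℕ → ℝ) (os : List (ULoop F)),
      𝔯.ne1 F θ hP g₀ os = ne1OfRecord l₀ Λ F θ hP g₀ os)
    (F : T4Family) (θ : Stage13HParams F N) (hP : θ.Provisos₁₃CoPH F N) (g₀ : ℕ → ℝ) (os : List (ULoop F)) (k : ℕ)
    {X : Type*} (Xs : Finset X) (sc : X → ℕ) (dA dB : X → ℝ) (vol : ℝ) (K : ℕ) :
    (∃ (pA : (rateCarriersOfRecord₁₃CoPH 𝔯 F θ hP g₀ os k).ne1.P)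
        (βA : X → ((rateCarriersOfRecord₁₃CoPH 𝔯 F θ hP g₀ os k).ne1.𝒯.B pA K).Birth)
        (Q : Finset ((rateCarriersOfRecord₁₃CoPH 𝔯 F θ hP g₀ os k).ne1.𝒯.B pA K).Cube)
        (pB : (rateCarriersOfRecord₁₃CoPH 𝔯 F θ hP g₀ os k).ne1.P) (KB : ℕ)
        (βB : X → ((rateCarriersOfRecord₁₃CoPH 𝔯 F θ hP g₀ os k).ne1.𝒯.B pB KB).Birth),
      (∀ x ∈ Xs, ((rateCarriersOfRecord₁₃CoPH 𝔯 F θ hP g₀ os k).ne1.𝒯.B pA K).birthScale (βA x) = sc x) ∧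
      (∀ j, Set.InjOn βA ↑(Xs.filter fun x => sc x = j)) ∧
      (∀ q ∈ Q, ((rateCarriersOfRecord₁₃CoPH 𝔯 F θ hP g₀ os k).ne1.𝒯.B pA K).cubeScale q = K) ∧ ((Q.card : ℝ) ≤ vol) ∧
      (∀ x ∈ Xs, ∃ q ∈ Q, βA x ∈ ((rateCarriersOfRecord₁₃CoPH 𝔯 F θ hP g₀ os k).ne1.𝒯.B pA K).feltAt q) ∧
      (∀ x ∈ Xs, KB - ((rateCarriersOfRecord₁₃CoPH 𝔯 F θ hP g₀ os k).ne1.𝒯.B pB KB).birthScale (βB x) = K - sc x) ∧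
      (∀ x ∈ Xs, dA x ≤ ((rateCarriersOfRecord₁₃CoPH 𝔯 F θ hP g₀ os k).ne1.𝒯.B pA K).size (βA x) K) ∧
      (∀ x ∈ Xs, dB x ≤ ((rateCarriersOfRecord₁₃CoPH 𝔯 F θ hP g₀ os k).ne1.𝒯.B pB KB).size (βB x) KB)) ↔
    ((∀ x ∈ Xs, sc x = K) ∧ Xs.card ≤ 1 ∧ ((Xs.card : ℝ) ≤ vol) ∧
      (∀ x ∈ Xs, dA x ≤ l₀ * obsSupNorm ((datumOfRecord₁₃CoPH F N θ hP).scheme g₀) K os) ∧ (∀ x ∈ Xs, dB x ≤ l₀)) :=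
  dressedRow_iff_oneTerm_of_eq_ne1OfRecord F θ hP g₀ os hl₀ (hpin F θ hP g₀ os) Xs sc dA dB vol K

/-- **THE ONE-TERM CLAUSE ⟹ ROW (ii-d) AT THE BUNDLE OF RECORD UNDER THE PIN EQUATION** [bookkeeping] — the direction a pinned edition of the link reading
CONSUMES (display the one-term clause, recover the six-binder clause for the edge of record); `0 ≤ l₀`. [folklore] -/
theorem dressedRow_rateCarriersOfRecord₁₃CoPH_of_oneTerm_of_pinned (hl₀ : 0 ≤ l₀)
    (hpin : ∀ (F : T4Family) (θ : Stage13HParams F N) (hP : θ.Provisos₁₃CoPH F N) (g₀ : ℕ → ℝ) (os : List (ULoop F)),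
      𝔯.ne1 F θ hP g₀ os = ne1OfRecord l₀ Λ F θ hP g₀ os)
    (F : T4Family) (θ : Stage13HParams F N) (hP : θ.Provisos₁₃CoPH F N) (g₀ : ℕ → ℝ) (os : List (ULoop F)) (k : ℕ)
    {X : Type*} (Xs : Finset X) (sc : X → ℕ) (dA dB : X → ℝ) (vol : ℝ) (K : ℕ)
    (h : (∀ x ∈ Xs, sc x = K) ∧ Xs.card ≤ 1 ∧ ((Xs.card : ℝ) ≤ vol) ∧
      (∀ x ∈ Xs, dA x ≤ l₀ * obsSupNorm ((datumOfRecord₁₃CoPH F N θ hP).scheme g₀) K os) ∧ (∀ x ∈ Xs, dB x ≤ l₀)) :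
    ∃ (pA : (rateCarriersOfRecord₁₃CoPH 𝔯 F θ hP g₀ os k).ne1.P)
        (βA : X → ((rateCarriersOfRecord₁₃CoPH 𝔯 F θ hP g₀ os k).ne1.𝒯.B pA K).Birth)
        (Q : Finset ((rateCarriersOfRecord₁₃CoPH 𝔯 F θ hP g₀ os k).ne1.𝒯.B pA K).Cube)
        (pB : (rateCarriersOfRecord₁₃CoPH 𝔯 F θ hP g₀ os k).ne1.P) (KB : ℕ)
        (βB : X → ((rateCarriersOfRecord₁₃CoPH 𝔯 F θ hP g₀ os k).ne1.𝒯.B pB KB).Birth),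
      (∀ x ∈ Xs, ((rateCarriersOfRecord₁₃CoPH 𝔯 F θ hP g₀ os k).ne1.𝒯.B pA K).birthScale (βA x) = sc x) ∧
      (∀ j, Set.InjOn βA ↑(Xs.filter fun x => sc x = j)) ∧
      (∀ q ∈ Q, ((rateCarriersOfRecord₁₃CoPH 𝔯 F θ hP g₀ os k).ne1.𝒯.B pA K).cubeScale q = K) ∧ ((Q.card : ℝ) ≤ vol) ∧
      (∀ x ∈ Xs, ∃ q ∈ Q, βA x ∈ ((rateCarriersOfRecord₁₃CoPH 𝔯 F θ hP g₀ os k).ne1.𝒯.B pA K).feltAt q) ∧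
      (∀ x ∈ Xs, KB - ((rateCarriersOfRecord₁₃CoPH 𝔯 F θ hP g₀ os k).ne1.𝒯.B pB KB).birthScale (βB x) = K - sc x) ∧
      (∀ x ∈ Xs, dA x ≤ ((rateCarriersOfRecord₁₃CoPH 𝔯 F θ hP g₀ os k).ne1.𝒯.B pA K).size (βA x) K) ∧
      (∀ x ∈ Xs, dB x ≤ ((rateCarriersOfRecord₁₃CoPH 𝔯 F θ hP g₀ os k).ne1.𝒯.B pB KB).size (βB x) KB) :=
  (dressedRow_rateCarriersOfRecord₁₃CoPH_iff_oneTerm_of_pinned 𝔯 hl₀ hpin F θ hP g₀ os k Xs sc dA dB vol K).mpr h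

/-- **ROW (iv) FROM THE PIN `Ne1PinnedOfRecord 𝔯` ALONE, AS THE READING BINDS IT** [bookkeeping]: at every tuple and run length SOME `N₀ ≥ 0`, `Λ₀ ≥ 0`,
`Λ₀ ≤ R.ne1.Λ` with the positional count — the four conjuncts of block (iv) with their two letters, witnesses `N₀ := 1`, `Λ₀ :=` the pin's `Λ`. [folklore] -/
theorem exists_positionalCount_row_rateCarriersOfRecord₁₃CoPH_of_ne1Pinned (h : Ne1PinnedOfRecord 𝔯)
    (F : T4Family) (θ : Stage13HParams F N) (hP : θ.Provisos₁₃CoPH F N) (g₀ : ℕ → ℝ) (os : List (ULoop F)) (k : ℕ) :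
    ∃ N₀ Λ₀ : ℝ,
      (∀ (p : (rateCarriersOfRecord₁₃CoPH 𝔯 F θ hP g₀ os k).ne1.P) (K : ℕ),
          ((rateCarriersOfRecord₁₃CoPH 𝔯 F θ hP g₀ os k).ne1.𝒯.B p K).PositionalCount fun j k' => N₀ * Λ₀ ^ (k' - j)) ∧
        0 ≤ N₀ ∧ 0 ≤ Λ₀ ∧ Λ₀ ≤ (rateCarriersOfRecord₁₃CoPH 𝔯 F θ hP g₀ os k).ne1.Λ := by
  obtain ⟨l₀, Λ, -, hΛ, hpin⟩ := h
  exact ⟨1, Λ, positionalCount_row_rateCarriersOfRecord₁₃CoPH_of_pinned 𝔯 hΛ hpin F θ hP g₀ os k⟩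

end Pinned

end Summit.QuantumFields.YangMills.BalabanUVNodes.N19DressedLedgerAtN14Pin

end
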